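import Summits.BirchSwinnertonDyer.BirchSwinnertonDyer.Theses.KatoDescentTamePotSupersingular
import Summits.BirchSwinnertonDyer.Rank1Residual.O6.X3KatoMemberBoundExactCountUpper
import HarnessLib

/-!
# Route `KatoDescentTamePotSupersingular` (rung K8, sub-rung B4 (t′), cell `bsd-potss`): the
# reducible-defect child `TameUpperReducibleDefect` (item stmt-BirchSwinnertonDyer-19203) of crux U₀
# FROM THE SHARPENED HULL READINGS, at every odd tame potentially supersingular `p`
# (a `--supports … --as helper` file)

Twin of `KatoDescentPotSupersingularWildUpperReducibleOfHull.lean` at a general odd additive prime: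
the reducible defect rows of U₀ (`W[p]` reducible with a `ℤ/p²` member — void for `p ≥ 5` by Mazur —
or odd `ord_p #Ш_an`) are covered by the SAME readings as crux M once the rank-`0` count at Kato's
member is read exactly (seat kmc part 14, `O6/X3KatoMemberBoundExactCount{,Upper}.lean`: Prop. 14.16 (2) with
`#H¹(ℤ[1/p],T)_tors`, exact Lemma T; `ord_p #Ш_an(W_K) = ord_p #Ш(W_K) + m`, `m ≥ 0`), transported
to every member by Cassels. This file states it with the ROUTE DECL as its type. CONDITIONAL (audit
`proof.conditional`); the item is NOT closed. Seat `bsd-potss-kmc` generation 7.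

References: [Kato2004Asterisque] 8.2, Thm. 12.5 (3), 12.6, (14.9.3), §14.14, Prop. 14.16 (2);
[Wuthrich2014] §3.2, Lemma 14; [MazurRubin2004] Thm. 2.3.4; [Cassels1965ArithmeticVIII]; [Miller2011LMS]
Def. 1.1.
-/

set_option autoImplicit false
-- sibling precedent (`KatoDescentTamePotSupersingularAssembly.lean`): the directory name repeats the summit name
set_option linter.dupNamespace false

noncomputable section

open scoped Classical

namespace Summit.BirchSwinnertonDyer.BirchSwinnertonDyer.Theorems

open WeierstrassCurve Literature.NumberTheory.EllipticCurves
  Literature.NumberTheory.EllipticCurves.Rank1Residual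
  Literature.NumberTheory.EllipticCurves.Rank1Residual.Typed
  Summit.BirchSwinnertonDyer.Rank1Residual.Additive
  Summit.BirchSwinnertonDyer.Rank1Residual
  Summit.BirchSwinnertonDyer.BirchSwinnertonDyer.Theses.KatoDescentTamePotSupersingular

variable {IsHullOf : ∀ (W : WeierstrassCurve ℚ) [W.IsElliptic] [W.IsGloballyMinimal] (p : ℕ)
  [Fact p.Prime], KatoHullDescentDatum p → Prop}

/-- **The upper half on EVERY reducible (t′) row of analytic rank `0`** (`p ≠ 2`, additive, `SubTprime`,
`W[p]` reducible ⟹ `MissingUpperBoundAt W p`), over the sharpened hull readings M1, M2, M3♯ and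
Cassels / GZK / modularity — `O6.x3PotGoodRankZeroUpper_of_hullReadingsSharp` (`ord_p j ≥ 0` from
`ClassO5 := ⟨p ≠ 2, Addv, Or.inr SubTprime⟩`). No `ℤ/p²` / parity hypothesis. Conditional; nothing
asserted. [cite: Kato2004Asterisque, Thm. 12.6 (p. 222), Prop. 14.16 (2) (p. 244)] [cite: Wuthrich2014, Lemma 14 (p. 396)]
[cite: Cassels1965ArithmeticVIII] -/
theorem tameUpperReducible_of_hullReadingsSharp (hM : KatoHull.MemberRealizable IsHullOf)
    (hD : KatoHull.DivisibilityReading IsHullOf) (hC : KatoHull.ExactCountReading IsHullOf)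
    (hCassels : bsdRHS_eq_of_isIsogenous) (hGZK : rank_eq_analyticRank_of_analyticRank_le_one)
    (hmod : hasEntireLFunction_rat)
    (W : WeierstrassCurve ℚ) [W.IsElliptic] [W.IsGloballyMinimal] (p : ℕ) [Fact p.Prime]
    (hr : W.analyticRank = 0) (hp : p ≠ 2) (hadd : Addv W p) (hT : SubTprime W p)
    (hred : ¬ W.HasIrreducibleModPGaloisRep p) : MissingUpperBoundAt W p :=
  have hO5 : ClassO5 W p := ⟨hp, hadd, Or.inr hT⟩
  O6.x3PotGoodRankZeroUpper_of_hullReadingsSharp hM hD hC hCassels hGZK hmod W p hp hadd.1 hadd.2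
    hO5.padicValRat_j_nonneg hred hr

/-- **The child item `TameUpperReducibleDefect` (stmt-BirchSwinnertonDyer-19203) over the sharpened hull
readings** (type = the route decl verbatim; its defect hypothesis is not used). Conditional over
displayed readings / named facts; the item is NOT closed.
[cite: Kato2004Asterisque, Thm. 12.6 (p. 222), §14.14 (p. 243), Prop. 14.16 (2) (p. 244)]
[cite: Wuthrich2014, §3.2 and Lemma 14 (pp. 394–396)] [cite: Cassels1965ArithmeticVIII] -/
theorem tameUpperReducibleDefect_of_hullReadingsSharp (hM : KatoHull.MemberRealizable IsHullOf)
    (hD : KatoHull.DivisibilityReading IsHullOf) (hC : KatoHull.ExactCountReading IsHullOf)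
    (hCassels : bsdRHS_eq_of_isIsogenous) (hGZK : rank_eq_analyticRank_of_analyticRank_le_one)
    (hmod : hasEntireLFunction_rat) :
    Summit.BirchSwinnertonDyer.BirchSwinnertonDyer.Theses.KatoDescentTamePotSupersingular.TameUpperReducibleDefect :=
  fun W _ _ p _ hr hp hadd hT hred _ ↦
    tameUpperReducible_of_hullReadingsSharp hM hD hC hCassels hGZK hmod W p hr hp hadd hT hred

end Summit.BirchSwinnertonDyer.BirchSwinnertonDyer.Theorems

end
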